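import Literature.Analysis.SegalBargmann.SchwartzFourierUnitary
import Literature.Analysis.SegalBargmann.HermiteCoefficients
import HarnessLib

/-!
# Ladder rigidity on `𝓢(ℝⁿ)`: an operator commuting with Folland's `Z_j`, `Z_j^*` is a scalar (Folland 1989, §1.7; the Schur step of (4.23))

Topic `Analysis/SegalBargmann`; namespace `Literature.Analysis.SegalBargmann`.  The tree has Folland's ladder operators
`zCLM j = X_j + iD_j`, `zsCLM j = X_j − iD_j` on `𝓢(EuclideanSpace ℝ σ, ℂ)` (`HermiteLadder`), their action on the
Hermite functions (`zCLM_herm`, `zsCLM_herm`), the bilinear transposition `bpair f (Z_j g) = bpair (Z_j^* f) g`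
(`HermiteCoefficients`), and the Hermite expansion IN `𝓢` (`HermiteExpansionSchwartz`; operator form
`clm_eq_of_eq_on_herm` in `SchwartzTorusIdentification`).  This file draws the SCHUR-type consequence on the Schwartz
space (the infinitesimal form of the irreducibility remark after Folland (4.23)):

* §1 `hermiteCoeff_zCLM : c_α(Z_j f) = √((α_j+1)/π) · c_{α+1_j}(f)` and **the vacuum kernel**
  `eq_smul_vac_of_forall_zCLM_eq_zero : (∀ j, Z_j g = 0) → g = c_0(g) • h_0`;
* §2 **ladder rigidity**: a CONTINUOUS linear `T : 𝓢 → 𝓢` commuting with every `Z_j` and every `Z_j^*` is the scalar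
  `c_0(T h_0)` (`clm_eq_smul_id_of_commute_ladder`); the same from commutation with the coordinates `x_j` and the
  momenta `D_j` (`clm_eq_smul_id_of_commute_coordMul_opD`);
* §3 transport to the Folland carrier `𝓢(σ → ℝ, ℂ)`: the conjugates of `coordMulCLM j` / `opDCLM j` by
  `schwartzTransport euclE` are the coordinate multiplier `smulLeftCLM (x ↦ x_j)` and `(2πi)⁻¹ ∂_{e_j}`
  (Mathlib `smulLeftCLM_compCLMOfContinuousLinearEquiv`, `lineDerivOp_compCLMOfContinuousLinearEquiv`), the Fourier
  conjugation identities `𝓕 (x_j f) = −(2πi)⁻¹∂_{e_j}(𝓕 f)`, `𝓕 ((2πi)⁻¹∂_{e_j} f) = x_j (𝓕 f)` for `fourierPi`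
  (`fourierPi_coordMulPi`, `fourierPi_lineDerivOp`), whence **`eq_smul_of_commute_coord_lineDeriv`**: a continuous
  `T : 𝓢(ℝ^σ) → 𝓢(ℝ^σ)` commuting with all `x_j·` and all `∂_{e_j}` is the scalar `c_0((e^*)⁻¹(T h_0))`
  (`∃`-form `clm_eq_smul_id_of_commute_coord_lineDeriv`).

Everything is proved from Mathlib and the imported tree files; no cited statement is used as a hypothesis.  Use
(pub-hodgecm, node W2-∞ continuous Schur, theta-1-g2 CS-A/CS-B): CS-A shows that a continuous operator commuting with
the Heisenberg operators `rhoS p q` commutes with `x_j·` and `∂_{e_j}`; §3 then finishes.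

## References

* [Folland1989] G. B. Folland, *Harmonic Analysis in Phase Space*, Princeton UP (1989), §1.7 (ladder operators,
  (1.82)), §4.2 (4.23) and the Schur remark following it. [cite: Folland1989, §1.7]

## Provenance

LEAN-IN-TREE rule (2026-08-18), pub-hodgecm model-construction sub-cell, seat mc-binder-2 gen 2 (Hermite half of the
continuous-Schur lemma for W2-∞-zp).
-/

set_option autoImplicit false

noncomputable section

open MeasureTheory Complex SchwartzMap Filter Topology
open scoped InnerProductSpace ComplexConjugate Real BigOperators

namespace Literature.Analysis.SegalBargmann

variable {σ : Type*} [Fintype σ] [DecidableEq σ]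

local notation "SR" σ => SchwartzMap (σ → ℝ) ℂ
local notation "SE" σ => SchwartzMap (EuclideanSpace ℝ σ) ℂ

/-! ## §1  Coefficients of `Z_j f` and the vacuum kernel -/

section Vacuum

/-- **`c_α(Z_j f) = √((α_j+1)/π) · c_{α+1_j}(f)`** (transpose `Z_j ↦ Z_j^*` under the bilinear pairing and the ladder
`Z_j^* h_α = √((α_j+1)/π) h_{α+1_j}`). [cite: Folland1989, §1.7] -/
theorem hermiteCoeff_zCLM (α : σ →₀ ℕ) (j : σ) (f : SE σ) :
    hermiteCoeff α (zCLM j f) =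
      (Real.sqrt ((α j + 1) / π) : ℂ) * hermiteCoeff (α + Finsupp.single j 1) f := by
  show bpair (hermiteSchwartz (herm α)) (zCLM j f) =
    _ * bpair (hermiteSchwartz (herm (α + Finsupp.single j 1))) f
  rw [bpair_zCLM, zsCLM_herm, bpair_smul_left]

omit [Fintype σ] in
/-- A non-zero multi-index is `β = (β − 1_j) + 1_j` for some `j` with `β_j ≠ 0`. [folklore] -/
theorem exists_eq_add_single_of_ne_zero {β : σ →₀ ℕ} (hβ : β ≠ 0) :
    ∃ j : σ, β j ≠ 0 ∧ β = (β - Finsupp.single j 1) + Finsupp.single j 1 := by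
  obtain ⟨j, hj⟩ : ∃ j, β j ≠ 0 := by
    by_contra h
    push Not at h
    exact hβ (Finsupp.ext fun j => by simpa using h j)
  refine ⟨j, hj, Finsupp.ext fun k => ?_⟩
  simp only [Finsupp.coe_add, Finsupp.coe_tsub, Pi.add_apply, Pi.sub_apply, Finsupp.single_apply]
  split_ifs with h
  · subst h; omega
  · omega

/-- **The vacuum kernel**: a Schwartz function annihilated by every `Z_j` is a multiple of the Gaussian `h_0`:
`g = c_0(g) • h_0`. [cite: Folland1989, §1.7] -/
theorem eq_smul_vac_of_forall_zCLM_eq_zero {g : SE σ} (hg : ∀ j : σ, zCLM j g = 0) :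
    g = hermiteCoeff 0 g • hermiteSchwartz (herm 0) := by
  refine ext_hermiteCoeff fun β => ?_
  rw [hermiteCoeff_smul, hermiteCoeff_herm]
  by_cases hβ : β = 0
  · subst hβ
    rw [if_pos rfl, mul_one]
  · rw [if_neg hβ, mul_zero]
    obtain ⟨j, hj, hdec⟩ := exists_eq_add_single_of_ne_zero hβ
    have h := hermiteCoeff_zCLM (β - Finsupp.single j 1) j g
    rw [hg j, ← hdec] at h
    have hc : hermiteCoeff (β - Finsupp.single j 1) (0 : SE σ) = 0 := by
      rw [← hermiteCoeffCLM_apply, map_zero]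
    rw [hc] at h
    have hpos : ∀ n : ℕ, (Real.sqrt (((n : ℝ) + 1) / π) : ℂ) ≠ 0 := fun n => by
      rw [Ne, Complex.ofReal_eq_zero, Real.sqrt_eq_zero']
      push Not
      positivity
    exact (mul_eq_zero.mp h.symm).resolve_left (hpos _)

end Vacuum

/-! ## §2  Ladder rigidity -/

section Ladder

/-- **Ladder rigidity.**  A continuous linear operator on `𝓢(EuclideanSpace ℝ σ, ℂ)` commuting with every annihilation
operator `Z_j` and every creation operator `Z_j^*` acts on each Hermite function `h_α` by the SAME scalar
`c = c_0(T h_0)`. [cite: Folland1989, §1.7] -/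
theorem apply_herm_eq_smul_of_commute_ladder (T : (SE σ) →L[ℂ] SE σ)
    (hZ : ∀ (j : σ) (f : SE σ), T (zCLM j f) = zCLM j (T f))
    (hZs : ∀ (j : σ) (f : SE σ), T (zsCLM j f) = zsCLM j (T f)) (α : σ →₀ ℕ) :
    T (hermiteSchwartz (herm α)) =
      hermiteCoeff 0 (T (hermiteSchwartz (herm 0))) • hermiteSchwartz (herm α) := by
  -- the vacuum: `Z_j (T h_0) = T (Z_j h_0) = 0`
  have h0 : T (hermiteSchwartz (herm 0)) = hermiteCoeff 0 (T (hermiteSchwartz (herm 0))) • hermiteSchwartz (herm 0) :=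
    eq_smul_vac_of_forall_zCLM_eq_zero fun j => by
      rw [← hZ, zCLM_herm]
      simp
  -- induction on the degree
  suffices h : ∀ (n : ℕ) (β : σ →₀ ℕ), β.degree = n →
      T (hermiteSchwartz (herm β)) = hermiteCoeff 0 (T (hermiteSchwartz (herm 0))) • hermiteSchwartz (herm β) from
    h _ α rfl
  intro n
  induction n with
  | zero =>
      intro β hβ
      rw [Finsupp.degree_eq_zero_iff] at hβ
      subst hβ
      exact h0
  | succ n ih =>
      intro β hβ
      have hβ0 : β ≠ 0 := by
        rintro rfl
        simp at hβ
      obtain ⟨j, hj, hdec⟩ := exists_eq_add_single_of_ne_zero hβ0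
      set γ := β - Finsupp.single j 1 with hγ
      have hγdeg : γ.degree = n := by
        have h1 : β.degree = γ.degree + 1 := by
          conv_lhs => rw [hdec]
          rw [map_add, Finsupp.degree_single]
        omega
      have hκ : (Real.sqrt ((γ j + 1) / π) : ℂ) ≠ 0 := by
        rw [Ne, Complex.ofReal_eq_zero, Real.sqrt_eq_zero']
        push Not
        positivity
      -- `h_β = κ⁻¹ • Z_j^* h_γ`
      have hup : hermiteSchwartz (herm β) = ((Real.sqrt ((γ j + 1) / π) : ℂ))⁻¹ • zsCLM j (hermiteSchwartz (herm γ)) := by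
        rw [zsCLM_herm, smul_smul, inv_mul_cancel₀ hκ, one_smul, ← hdec]
      rw [hup, map_smul, hZs, ih γ hγdeg, map_smul, smul_comm]

/-- **Hence `T` is a scalar**: `T = c_0(T h_0) • id` on all of `𝓢(EuclideanSpace ℝ σ, ℂ)` (density of the Hermite
expansion in the Schwartz topology, `clm_eq_of_eq_on_herm`). [cite: Folland1989, §1.7] -/
theorem clm_eq_smul_id_of_commute_ladder (T : (SE σ) →L[ℂ] SE σ)
    (hZ : ∀ (j : σ) (f : SE σ), T (zCLM j f) = zCLM j (T f))
    (hZs : ∀ (j : σ) (f : SE σ), T (zsCLM j f) = zsCLM j (T f)) :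
    T = hermiteCoeff 0 (T (hermiteSchwartz (herm 0))) • ContinuousLinearMap.id ℂ (SE σ) :=
  clm_eq_of_eq_on_herm fun β => by
    rw [apply_herm_eq_smul_of_commute_ladder T hZ hZs β, _root_.smul_apply,
      ContinuousLinearMap.id_apply]

/-- **The same from the coordinates and momenta**: a continuous operator commuting with every `x_j·` (`coordMulCLM j`)
and every `D_j = (2πi)⁻¹∂_j` (`opDCLM j`) is a scalar (it then commutes with `Z_j = x_j + iD_j`, `Z_j^* = x_j − iD_j`).
[cite: Folland1989, §1.7] -/
theorem clm_eq_smul_id_of_commute_coordMul_opD (T : (SE σ) →L[ℂ] SE σ)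
    (hX : ∀ (j : σ) (f : SE σ), T (coordMulCLM j f) = coordMulCLM j (T f))
    (hD : ∀ (j : σ) (f : SE σ), T (opDCLM j f) = opDCLM j (T f)) :
    T = hermiteCoeff 0 (T (hermiteSchwartz (herm 0))) • ContinuousLinearMap.id ℂ (SE σ) := by
  refine clm_eq_smul_id_of_commute_ladder T (fun j f => ?_) (fun j f => ?_)
  · show T ((coordMulCLM j + I • opDCLM j) f) = (coordMulCLM j + I • opDCLM j) (T f)
    simp only [_root_.add_apply, _root_.smul_apply, map_add, map_smul, hX, hD]
  · show T ((coordMulCLM j - I • opDCLM j) f) = (coordMulCLM j - I • opDCLM j) (T f)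
    simp only [_root_.sub_apply, _root_.smul_apply, map_sub, map_smul, hX, hD]

end Ladder

/-! ## §3  Transport to the Folland carrier `𝓢(σ → ℝ, ℂ)` -/

section Folland

omit [DecidableEq σ] in
/-- The `j`-th coordinate, cast to `ℂ`, has temperate growth on `σ → ℝ`. [folklore] -/
theorem hasTemperateGrowth_coordPi (j : σ) : (fun x : σ → ℝ => ((x j : ℝ) : ℂ)).HasTemperateGrowth := by
  have h1 : (fun x : σ → ℝ => x j).HasTemperateGrowth :=
    (ContinuousLinearMap.proj (R := ℝ) (φ := fun _ : σ => ℝ) j).hasTemperateGrowth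
  exact Complex.ofRealCLM.hasTemperateGrowth.comp h1

/-- **The coordinate multiplier on the Folland carrier** `(x_j · f)`. [folklore] -/
def coordMulPi (j : σ) : (SR σ) →L[ℂ] SR σ := SchwartzMap.smulLeftCLM ℂ (fun x : σ → ℝ => ((x j : ℝ) : ℂ))

omit [DecidableEq σ] in
/-- Pointwise: `coordMulPi j f x = x_j f x`. [folklore] -/
@[simp] theorem coordMulPi_apply (j : σ) (f : SR σ) (x : σ → ℝ) : coordMulPi j f x = ((x j : ℝ) : ℂ) * f x := by
  rw [coordMulPi, SchwartzMap.smulLeftCLM_apply_apply (hasTemperateGrowth_coordPi j), smul_eq_mul]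

omit [DecidableEq σ] in
/-- **Transport of `x_j·`**: `e^* ∘ coordMulCLM j ∘ (e^*)⁻¹ = coordMulPi j`. [folklore] -/
theorem schwartzTransport_coordMulCLM (j : σ) (f : SR σ) :
    schwartzTransport (euclE σ) (coordMulCLM j ((schwartzTransport (euclE σ)).symm f)) = coordMulPi j f := by
  ext x
  rw [schwartzTransport_apply, coordMulCLM_apply, schwartzTransport_symm_apply, coordMulPi_apply,
    ContinuousLinearEquiv.apply_symm_apply, coe_euclE_symm_apply]

/-- **Transport of `D_j`**: `e^* ∘ opDCLM j ∘ (e^*)⁻¹ = (2πi)⁻¹ ∂_{e_j}` on `𝓢(σ → ℝ, ℂ)` (Mathlib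
`lineDerivOp_compCLMOfContinuousLinearEquiv`). [folklore] -/
theorem schwartzTransport_opDCLM (j : σ) (f : SR σ) :
    schwartzTransport (euclE σ) (opDCLM j ((schwartzTransport (euclE σ)).symm f)) =
      (2 * π * I : ℂ)⁻¹ • LineDeriv.lineDerivOp (Pi.single j (1 : ℝ) : σ → ℝ) f := by
  have h1 : (schwartzTransport (euclE σ)).symm f = SchwartzMap.compCLMOfContinuousLinearEquiv ℂ (euclE σ) f := rfl
  have h2 : ∀ g : SE σ, schwartzTransport (euclE σ) g = SchwartzMap.compCLMOfContinuousLinearEquiv ℂ (euclE σ).symm g :=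
    fun g => rfl
  have hs : (euclE σ) (EuclideanSpace.single j (1 : ℝ)) = (Pi.single j (1 : ℝ) : σ → ℝ) := rfl
  rw [opDCLM, _root_.smul_apply, map_smul, h2, LineDeriv.lineDerivOpCLM_apply, h1,
    SchwartzMap.lineDerivOp_compCLMOfContinuousLinearEquiv, hs]
  congr 1

omit [DecidableEq σ] in
/-- `(e^*)⁻¹ ∘ coordMulPi j = coordMulCLM j ∘ (e^*)⁻¹`. [folklore] -/
theorem schwartzTransport_symm_coordMulPi (j : σ) (f : SR σ) :
    (schwartzTransport (euclE σ)).symm (coordMulPi j f) = coordMulCLM j ((schwartzTransport (euclE σ)).symm f) := by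
  apply (schwartzTransport (euclE σ)).injective
  rw [ContinuousLinearEquiv.apply_symm_apply, schwartzTransport_coordMulCLM]

/-- `(e^*)⁻¹ ((2πi)⁻¹ ∂_{e_j} f) = opDCLM j ((e^*)⁻¹ f)`. [folklore] -/
theorem schwartzTransport_symm_lineDerivOp (j : σ) (f : SR σ) :
    (schwartzTransport (euclE σ)).symm ((2 * π * I : ℂ)⁻¹ • LineDeriv.lineDerivOp (Pi.single j (1 : ℝ) : σ → ℝ) f) =
      opDCLM j ((schwartzTransport (euclE σ)).symm f) := by
  apply (schwartzTransport (euclE σ)).injective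
  rw [ContinuousLinearEquiv.apply_symm_apply, schwartzTransport_opDCLM]

/-- **`𝓕 (x_j f) = −(2πi)⁻¹ ∂_{e_j} (𝓕 f)`** on `𝓢(σ → ℝ, ℂ)` (tree `HermiteFourier.fourier_coordMulCLM`, transported;
`fourierPi` of `SchwartzFourierUnitary`). [cite: Folland1989, §1.7] -/
theorem fourierPi_coordMulPi (j : σ) (f : SR σ) :
    fourierPi (coordMulPi j f) = -((2 * π * I : ℂ)⁻¹ • LineDeriv.lineDerivOp (Pi.single j (1 : ℝ) : σ → ℝ) (fourierPi f)) := by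
  rw [fourierPi_apply, schwartzTransport_symm_coordMulPi, fourier_coordMulCLM, map_neg, ← schwartzTransport_opDCLM,
    fourierPi_apply, ContinuousLinearEquiv.symm_apply_apply]

/-- **`𝓕 ((2πi)⁻¹ ∂_{e_j} f) = x_j (𝓕 f)`** on `𝓢(σ → ℝ, ℂ)` (tree `HermiteFourier.fourier_opDCLM`, transported).
[cite: Folland1989, §1.7] -/
theorem fourierPi_lineDerivOp (j : σ) (f : SR σ) :
    fourierPi ((2 * π * I : ℂ)⁻¹ • LineDeriv.lineDerivOp (Pi.single j (1 : ℝ) : σ → ℝ) f) = coordMulPi j (fourierPi f) := by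
  rw [fourierPi_apply, schwartzTransport_symm_lineDerivOp, fourier_opDCLM, ← schwartzTransport_coordMulCLM, fourierPi_apply,
    ContinuousLinearEquiv.symm_apply_apply]

/-- **Rigidity on the Folland carrier, explicit constant.**  A continuous linear operator on `𝓢(σ → ℝ, ℂ)` commuting
with every coordinate multiplier `x_j·` (Mathlib `SchwartzMap.smulLeftCLM ℂ (fun x => ((x j : ℝ) : ℂ))`) and every
partial derivative `∂_{Pi.single j 1}` (Mathlib `LineDeriv.lineDerivOp`) is the scalar
`c = c_0((e^*)⁻¹ (T h_0))` (the `0`-th Hermite coefficient of the image of the Gaussian): `T f = c • f` for all `f`.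
[cite: Folland1989, §1.7] -/
theorem eq_smul_of_commute_coord_lineDeriv (T : (SR σ) →L[ℂ] SR σ)
    (hX : ∀ (j : σ) (f : SR σ), T (SchwartzMap.smulLeftCLM ℂ (fun x : σ → ℝ => ((x j : ℝ) : ℂ)) f) =
      SchwartzMap.smulLeftCLM ℂ (fun x : σ → ℝ => ((x j : ℝ) : ℂ)) (T f))
    (hD : ∀ (j : σ) (f : SR σ),
      T (LineDeriv.lineDerivOp (Pi.single j (1 : ℝ) : σ → ℝ) f) =
        LineDeriv.lineDerivOp (Pi.single j (1 : ℝ) : σ → ℝ) (T f)) (f : SR σ) :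
    T f = hermiteCoeff 0 ((schwartzTransport (euclE σ)).symm (T (hermitePi 0))) • f := by
  have hXc : ∀ (j : σ) (f : SR σ), T (coordMulPi j f) = coordMulPi j (T f) := fun j f => hX j f
  -- conjugate `T` to the Euclidean carrier
  let T' : (SE σ) →L[ℂ] SE σ :=
    (((schwartzTransport (euclE σ)).symm : (SR σ) →L[ℂ] SE σ).comp T).comp
      (schwartzTransport (euclE σ) : (SE σ) →L[ℂ] SR σ)
  have hT'apply : ∀ g : SE σ,
      T' g = (schwartzTransport (euclE σ)).symm (T (schwartzTransport (euclE σ) g)) := fun g => rfl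
  have hX' : ∀ (j : σ) (g : SE σ), T' (coordMulCLM j g) = coordMulCLM j (T' g) := fun j g => by
    rw [hT'apply, hT'apply, ← schwartzTransport_symm_coordMulPi, ← hXc]
    congr 2
    conv_lhs => rw [← (schwartzTransport (euclE σ)).symm_apply_apply g]
    rw [schwartzTransport_coordMulCLM]
  have hD' : ∀ (j : σ) (g : SE σ), T' (opDCLM j g) = opDCLM j (T' g) := fun j g => by
    rw [hT'apply, hT'apply, ← schwartzTransport_symm_lineDerivOp, ← hD, ← map_smul]
    congr 2
    conv_lhs => rw [← (schwartzTransport (euclE σ)).symm_apply_apply g]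
    rw [schwartzTransport_opDCLM]
  have h := congrArg (fun R : (SE σ) →L[ℂ] SE σ =>
    schwartzTransport (euclE σ) (R ((schwartzTransport (euclE σ)).symm f)))
    (clm_eq_smul_id_of_commute_coordMul_opD T' hX' hD')
  simp only [hT'apply, ContinuousLinearEquiv.apply_symm_apply, _root_.smul_apply, ContinuousLinearMap.id_apply,
    map_smul, schwartzTransport_hermiteSchwartz] at h
  exact h

/-- **Rigidity on the Folland carrier**, `∃`-form over the named operators `coordMulPi j`. [cite: Folland1989, §1.7] -/
theorem clm_eq_smul_id_of_commute_coord_lineDeriv (T : (SR σ) →L[ℂ] SR σ)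
    (hX : ∀ (j : σ) (f : SR σ), T (coordMulPi j f) = coordMulPi j (T f))
    (hD : ∀ (j : σ) (f : SR σ),
      T (LineDeriv.lineDerivOp (Pi.single j (1 : ℝ) : σ → ℝ) f) =
        LineDeriv.lineDerivOp (Pi.single j (1 : ℝ) : σ → ℝ) (T f)) :
    ∃ c : ℂ, T = c • ContinuousLinearMap.id ℂ (SR σ) :=
  ⟨_, ContinuousLinearMap.ext fun f => by
    rw [eq_smul_of_commute_coord_lineDeriv T hX hD f, _root_.smul_apply, ContinuousLinearMap.id_apply]⟩

end Folland

end Literature.Analysis.SegalBargmann
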